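import Summits.QuantumFields.YangMills.Theorems.UnitScaleTiltProp7SectET3NormH1Pin
import Literature.MathematicalPhysics.QuantumFieldTheory.Balaban1983to89.B9CoRealizesHRel
import HarnessLib

/-!
# Route `UnitScaleTilt`, crux «MinimiserStabilityRegPr» (stmt-QuantumFields-19200, v10 stub EX, route (α), node N06(d = 3)) — the `norm_H₁` half of the knit, CONSISTENCY OF THE PIN:
# **THE CANONICAL (3.133) ENTRIES OF A MODEL OPERATOR** — for ANY pair of ℝ-linear model operators (`H₁`, `∇_U H₁`) fibred over the coarse lattice there IS an H-kernel reading
# `Hk : B9.HKernel` whose sup entries satisfy AT ONCE the Theorem 3.12 leaf's co-readings `CoRealizesHRel` (entries ≤ every valid bound) AND the fibrewise domination of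
# ✓ `Prop7SectET3NormH1Pin` (operator ≤ entries): the suprema `e n U y y′ := sup {|(A b)(x)|∕(L^{j′}η)^d : b a test vector at y′, x over y}`

Cell `ym3-torus` (HUMAN RULING D-0037, YM ladder rung R3 — NOT the Clay problem), width seat ym-ust-20520-w1 g4 (offer (o-7), the closing piece of the seat's `norm_H₁` lane).  Count-neutral
helper (`--supports stmt-QuantumFields-19200 --as helper`); registry untouched; THEOREMS ONLY (0 `def`, 0 `sorry` — the kernel lives inside an `∃`); Mathlib-only over ✓ p607960 and
`B9CoRealizesHRel`; NOTHING of [Balaban1985BackgroundPropagators] is asserted.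

THE PRINT ∕ THE TREE.  [Balaban1985BackgroundPropagators] (3.133) p. 422 bounds the quantities *«|H_{μν}(x, y′)|, |∇H_{μν}(x, y′)| … for x ∈ Δ(y), … y′ ∈ Λ_{j′}»*; the tree carries them as
REALS `B9.HKernel.e n U y y′` (*«sup_{x∈Δ(y)}|H(x,y′)|, sup_{x∈Δ(y)}|∇H(x,y′)|»*, `B9CoRealizesHRel` header) pinned to the model operators `(𝔬 i).H1m U`, `(𝔬 i).D U ∘ (𝔬 i).H1m U` of the
Theorem 3.12 leaf ONLY through the co-reading `CoRealizesHRel.obs` («every valid bound of the operator on test vectors at y′ bounds the entry»), i.e. `e ≤ sup`; the `norm_H₁` consumer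
(✓ `Prop7SectET3NormH1` ∕ `…NormH1Pin` ∕ `…N06LeavesRecordNormH1`) needs the converse «operator ≤ entries», i.e. `sup ≤ e`.  THIS FILE shows the two schemas are JOINTLY inhabited —
by `e := sup` —, so displaying both (the leaf's `hcoHR` and the pin `hpin`∕`hdom`) for the SAME `H₁k` is consistent and costs the eventual supplier nothing beyond choosing the canonical
reading: the finite-dimensional bookkeeping print leaves implicit when it writes «sup_{x∈Δ(y)}».

WHAT IS PROVED (ns `…Theorems.Prop7SectET3NormH1Canonical`; input carrier `v → ℝ` with the sup norm, as in the leaf's `Ops` model).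
* §1 ★ `abs_apply_le_colSum` — for an ℝ-linear `A : (v → ℝ) →ₗ[ℝ] (u → ℝ)` and a test vector `|b| ≤ 1`: `|(A b)(x)| ≤ Σ_{x′} |(A e_{x′})(x)| ≤ Σ_{x″} Σ_{x′} |(A e_{x′})(x″)|` (the bound making the
  suprema finite); ★★ `exists_entry_canonical` — for a background-indexed family `A U` fibred by `bv : v → 𝔅` (inputs) and read at outputs `x` over `y` through `Rel (bu x) y`: there is
  `e : Cfg → 𝔅 → 𝔅 → ℝ` with (i) `0 ≤ e`, (ii) the CO-READING clause of `CoRealizesHRel.obs` (minimality of the sup), (iii) FIBREWISE DOMINATION `|(A U b)(x)| ≤ e U y y′·len(y′)^d·‖b‖`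
  for every `b` supported on `bv⁻¹(y′)` and every `x` with `Rel (bu x) y` (maximality of the sup, after rescaling `b` to a test vector).
* §2 ★★★ `exists_hKernel_canonical` — for the TWO operators of the leaf's H₁-co-readings (`A₀ U` on the value carrier `u₀` attached by `bu₀`, `A₁ U` on the gradient carrier `u₁` attached by
  `bu₁`; at the T³ leaf `(𝔬 i).H1m U` ∕ `(𝔬 i).D U ∘ₗ (𝔬 i).H1m U` with `blk` ∕ `blkY`, inputs `blkZ`, `Rel := RelB i`) and ANY Hölder member `hH`: `∃ Hk : B9.HKernel g B` with `Hk.h = hH`,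
  `CoRealizesHRel Hk 0 U d Rel bu₀ bv (A₀ U)` and `CoRealizesHRel Hk 1 U d Rel bu₁ bv (A₁ U)` for every `U` (the leaf's `hcoHR` conjuncts for this kernel), `0 ≤ Hk.e`, and the two
  fibrewise dominations (the `hdom` of ✓ `weightedPin_of_fibrewise` ∕ `jetPins_of_fibrewise` at any attaching map `σ` with `Rel (bu (·)) (σ ·)`, e.g. `σ := bu` when `Rel` is reflexive).
HONEST SCOPE: finite sums and real suprema ([folklore]); the Hölder member `Hk.h` is NOT made canonical (a parameter; the `norm_H₁` consumer reads only `Hk.e`); no estimate of [B9]; the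
route's curved letter `H₁f` is still not DEFINED (NE9 (L6)); N06(d = 3) NOT discharged; nothing here claims EX, the crux, V3∕R3, d = 4 or the mass gap; YM₃ on T³ is ladder rung R3,
not the Clay problem.

References: T. Bałaban, CMP 99 (1985) 389–434 [Balaban1985BackgroundPropagators] ((3.126) p.420, (3.133) p.422); CMP 102 (1985) 277–309 [Balaban1985Variational] ((103) p.293); CMP 96
(1984) 223–250 [Balaban1984PropagatorsII] ((2.51)–(2.52) p.232).
-/

set_option autoImplicit false

noncomputable section

namespace Summit.QuantumFields.YangMills.Theorems.Prop7SectET3NormH1Canonical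

open Literature.MathematicalPhysics.QuantumFieldTheory.Balaban1983to89
open Literature.MathematicalPhysics.QuantumFieldTheory.Balaban1983to89.B9CoRealizesHRel (CoRealizesHRel)

/-! ## §1 One operator: the column-sum bound and the canonical entries -/

section OneOperator

variable {g : B9.Geometry} {B : B9.Backgrounds} {u v : Type} [Fintype u] [Fintype v] [DecidableEq v]

/-- ★ **The column-sum bound** (finiteness of the suprema): for an ℝ-linear `A` and a test vector `|b| ≤ 1`, `|(A b)(x)| ≤ Σ_{x′} |(A e_{x′})(x)|` (expand `b = Σ_{x′} b(x′)·e_{x′}`), and the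
right side is at most the double sum over all outputs. [folklore] -/
theorem abs_apply_le_colSum (A : (v → ℝ) →ₗ[ℝ] (u → ℝ)) (b : v → ℝ) (hb : ∀ x' : v, |b x'| ≤ 1) (x : u) :
    |A b x| ≤ ∑ x'' : u, ∑ x' : v, |A (Pi.single x' 1) x''| := by
  have hdec : A b x = ∑ x' : v, b x' * A (Pi.single x' 1) x := by
    conv_lhs => rw [pi_eq_sum_univ' b]
    rw [map_sum, Finset.sum_apply]
    refine Finset.sum_congr rfl fun x' _ => ?_
    rw [map_smul, Pi.smul_apply, smul_eq_mul]
  calc |A b x| = |∑ x' : v, b x' * A (Pi.single x' 1) x| := by rw [hdec]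
    _ ≤ ∑ x' : v, |b x' * A (Pi.single x' 1) x| := Finset.abs_sum_le_sum_abs _ _
    _ ≤ ∑ x' : v, |A (Pi.single x' 1) x| := Finset.sum_le_sum fun x' _ => by
        rw [abs_mul]
        exact (mul_le_mul_of_nonneg_right (hb x') (abs_nonneg _)).trans (by rw [one_mul])
    _ ≤ ∑ x'' : u, ∑ x' : v, |A (Pi.single x' 1) x''| :=
        Finset.single_le_sum (f := fun x'' => ∑ x' : v, |A (Pi.single x' 1) x''|) (fun x'' _ => Finset.sum_nonneg fun x' _ => abs_nonneg _) (Finset.mem_univ x)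

/-- ★★ **THE CANONICAL ENTRIES OF ONE BACKGROUND-INDEXED OPERATOR**: `e U y y′ := sup ({0} ∪ {|(A U b)(x)|∕len(y′)^d : b supported on bv⁻¹(y′), |b| ≤ 1, Rel (bu x) y})` has (i) `0 ≤ e`,
(ii) the co-reading clause of `CoRealizesHRel.obs` (entries BELOW every valid bound), (iii) fibrewise domination of the operator BY the entries (after rescaling any `b` to a test vector).
[cite: Balaban1985BackgroundPropagators, (3.133) p.422, (3.126) p.420; Balaban1984PropagatorsII, (2.51) p.232] -/
theorem exists_entry_canonical (d : ℕ) (Rel : g.Site → g.Site → Prop) (bv : v → g.Site) (bu : u → g.Site) (A : B.Cfg → (v → ℝ) →ₗ[ℝ] (u → ℝ))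
    (hlen : ∀ y : g.Site, 0 < g.len y) :
    ∃ e : B.Cfg → g.Site → g.Site → ℝ,
      (∀ U y y', 0 ≤ e U y y') ∧
      (∀ (U : B.Cfg) (y y' : g.Site) (c : ℝ), 0 ≤ c →
        (∀ b : v → ℝ, (∀ x', bv x' ≠ y' → b x' = 0) → (∀ x', |b x'| ≤ 1) → ∀ x : u, Rel (bu x) y → |A U b x| ≤ c * (g.len y') ^ (d : ℝ)) →
          e U y y' ≤ c) ∧
      (∀ (U : B.Cfg) (y y' : g.Site) (b : v → ℝ) (x : u), (∀ x', bv x' ≠ y' → b x' = 0) → Rel (bu x) y →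
        |A U b x| ≤ e U y y' * (g.len y') ^ (d : ℝ) * ‖b‖) := by
  classical
  -- the entry sets and their bound
  let S : B.Cfg → g.Site → g.Site → Set ℝ := fun U y y' =>
    insert 0 {r | ∃ (b : v → ℝ) (x : u), (∀ x', bv x' ≠ y' → b x' = 0) ∧ (∀ x', |b x'| ≤ 1) ∧ Rel (bu x) y ∧ r = |A U b x| / (g.len y') ^ (d : ℝ)}
  have hld : ∀ y' : g.Site, 0 < (g.len y') ^ (d : ℝ) := fun y' => Real.rpow_pos_of_pos (hlen y') _
  have hbdd : ∀ U y y', BddAbove (S U y y') := by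
    intro U y y'
    refine ⟨(∑ x'' : u, ∑ x' : v, |A U (Pi.single x' 1) x''|) / (g.len y') ^ (d : ℝ), fun r hr => ?_⟩
    rcases Set.mem_insert_iff.1 hr with h0 | ⟨b, x, _, hb1, _, rfl⟩
    · rw [h0]
      exact div_nonneg (Finset.sum_nonneg fun _ _ => Finset.sum_nonneg fun _ _ => abs_nonneg _) (hld y').le
    · exact div_le_div_of_nonneg_right (abs_apply_le_colSum (A U) b hb1 x) (hld y').le
  have hne : ∀ U y y', (S U y y').Nonempty := fun U y y' => ⟨0, Set.mem_insert 0 _⟩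
  refine ⟨fun U y y' => sSup (S U y y'), fun U y y' => le_csSup (hbdd U y y') (Set.mem_insert 0 _), fun U y y' c hc hobs => ?_, fun U y y' b x hb hx => ?_⟩
  · -- (ii) minimality of the sup: every member of `S` is `≤ c`
    refine csSup_le (hne U y y') fun r hr => ?_
    rcases Set.mem_insert_iff.1 hr with h0 | ⟨b, x, hb0, hb1, hx, rfl⟩
    · rw [h0]; exact hc
    · rw [div_le_iff₀ (hld y')]
      exact hobs b hb0 hb1 x hx
  · -- (iii) domination: rescale `b` to a test vector
    by_cases hb0 : ‖b‖ = 0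
    · have hbz : b = 0 := norm_eq_zero.1 hb0
      rw [hbz, map_zero, Pi.zero_apply, abs_zero, norm_zero, mul_zero]
    · have hbpos : 0 < ‖b‖ := lt_of_le_of_ne (norm_nonneg b) (Ne.symm hb0)
      have htest1 : ∀ x', |(‖b‖⁻¹ • b) x'| ≤ 1 := by
        intro x'
        rw [Pi.smul_apply, smul_eq_mul, abs_mul, abs_inv, abs_norm, inv_mul_le_iff₀ hbpos, mul_one]
        exact (Real.norm_eq_abs (b x')).symm.le.trans (norm_le_pi_norm b x')
      have htest0 : ∀ x', bv x' ≠ y' → (‖b‖⁻¹ • b) x' = 0 := fun x' hx' => by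
        rw [Pi.smul_apply, smul_eq_mul, hb x' hx', mul_zero]
      have hmem : |A U (‖b‖⁻¹ • b) x| / (g.len y') ^ (d : ℝ) ∈ S U y y' :=
        Set.mem_insert_of_mem 0 ⟨‖b‖⁻¹ • b, x, htest0, htest1, hx, rfl⟩
      have hle := le_csSup (hbdd U y y') hmem
      rw [div_le_iff₀ (hld y'), map_smul, Pi.smul_apply, smul_eq_mul, abs_mul, abs_inv, abs_norm,
        inv_mul_le_iff₀ hbpos] at hle
      calc |A U b x| ≤ ‖b‖ * (sSup (S U y y') * (g.len y') ^ (d : ℝ)) := hle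
        _ = sSup (S U y y') * (g.len y') ^ (d : ℝ) * ‖b‖ := by ring

end OneOperator

/-! ## §2 The canonical H-kernel for the two operators of the leaf's H₁-co-readings -/

section TwoOperators

variable {g : B9.Geometry} {B : B9.Backgrounds} {u₀ u₁ v : Type} [Fintype u₀] [Fintype u₁] [Fintype v] [DecidableEq v]

/-- ★★★ **THE CANONICAL H-KERNEL**: for the value operator `A₀ U` (outputs `u₀` attached to `𝔅` by `bu₀`) and the gradient operator `A₁ U` (outputs `u₁`, `bu₁`) on inputs `v → ℝ` fibred by
`bv`, a block equivalence `Rel`, the pairing exponent `d` and ANY Hölder member `hH`, there is `Hk : B9.HKernel g B` with `Hk.h = hH` such that for every `U`: the leaf's co-readings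
`CoRealizesHRel Hk 0 U d Rel bu₀ bv (A₀ U)`, `CoRealizesHRel Hk 1 U d Rel bu₁ bv (A₁ U)` hold, `0 ≤ Hk.e n U`, and the operators are FIBREWISE DOMINATED by the entries
(`|(A₀ U b)(x)| ≤ Hk.e 0 U y y′·len(y′)^d·‖b‖` for `b` supported on `bv⁻¹(y′)` and `Rel (bu₀ x) y`; likewise `n = 1`) — the `hdom` rows of ✓ `Prop7SectET3NormH1Pin` (at `σ := bu`
when `Rel` is reflexive).  So the leaf's `hcoHR` and the `norm_H₁` pin are consistent displayed rows for ONE kernel. [cite: Balaban1985BackgroundPropagators, (3.133) p.422, (3.126) p.420; Balaban1985Variational, (103) p.293] -/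
theorem exists_hKernel_canonical (d : ℕ) (Rel : g.Site → g.Site → Prop) (bv : v → g.Site) (bu₀ : u₀ → g.Site) (bu₁ : u₁ → g.Site)
    (A₀ : B.Cfg → (v → ℝ) →ₗ[ℝ] (u₀ → ℝ)) (A₁ : B.Cfg → (v → ℝ) →ₗ[ℝ] (u₁ → ℝ)) (hH : B.Cfg → ℝ → g.Cut → g.Site → ℝ)
    (hlen : ∀ y : g.Site, 0 < g.len y) :
    ∃ Hk : B9.HKernel g B, Hk.h = hH ∧
      (∀ U : B.Cfg, CoRealizesHRel Hk 0 U d Rel bu₀ bv (A₀ U)) ∧ (∀ U : B.Cfg, CoRealizesHRel Hk 1 U d Rel bu₁ bv (A₁ U)) ∧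
      (∀ (n : Fin 2) (U : B.Cfg) (y y' : g.Site), 0 ≤ Hk.e n U y y') ∧
      (∀ (U : B.Cfg) (y y' : g.Site) (b : v → ℝ) (x : u₀), (∀ x', bv x' ≠ y' → b x' = 0) → Rel (bu₀ x) y →
        |A₀ U b x| ≤ Hk.e 0 U y y' * (g.len y') ^ (d : ℝ) * ‖b‖) ∧
      (∀ (U : B.Cfg) (y y' : g.Site) (b : v → ℝ) (x : u₁), (∀ x', bv x' ≠ y' → b x' = 0) → Rel (bu₁ x) y →
        |A₁ U b x| ≤ Hk.e 1 U y y' * (g.len y') ^ (d : ℝ) * ‖b‖) := by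
  obtain ⟨e₀, h0₀, hco₀, hdom₀⟩ := exists_entry_canonical (B := B) d Rel bv bu₀ A₀ hlen
  obtain ⟨e₁, h0₁, hco₁, hdom₁⟩ := exists_entry_canonical (B := B) d Rel bv bu₁ A₁ hlen
  refine ⟨⟨![e₀, e₁], hH⟩, rfl, fun U => ⟨fun y y' c hc h => ?_⟩, fun U => ⟨fun y y' c hc h => ?_⟩, ?_, fun U y y' b x hb hx => ?_, fun U y y' b x hb hx => ?_⟩
  · simpa using hco₀ U y y' c hc h
  · simpa using hco₁ U y y' c hc h
  · intro n U y y'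
    fin_cases n
    · simpa using h0₀ U y y'
    · simpa using h0₁ U y y'
  · simpa using hdom₀ U y y' b x hb hx
  · simpa using hdom₁ U y y' b x hb hx

end TwoOperators

end Summit.QuantumFields.YangMills.Theorems.Prop7SectET3NormH1Canonical

end
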